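import Summits.PneNP.PneNP.Theses.EcdlpDefinability

/-!
# Route EcdlpDefinability — `LegendreFingerprint` (stmt-PneNP-2077)

For `u ≠ u'` in `𝔽_p`, `#{c : (u+c is a square) ↔ (u'+c is a square)} ≤ p/2 + 2`. For odd `p`, with the quadratic character
`χ` (`χ a = −1 ↔ a` is a non-square): the character sum `Σ_c χ(u+c)χ(u'+c) = Σ_x χ(x(x+a)) = Σ_{x ≠ 0} χ(1 + a/x) =
Σ_{y ≠ 1} χ(y) = −1` (`a = u' − u ≠ 0`), so among the `p − 2` shifts with both values nonzero exactly `(p−1)/2` have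
`χ(u+c)χ(u'+c) = −1`, and those shifts distinguish `u` from `u'`; hence at most `p − (p−1)/2 = (p+1)/2` agreements.
-/

set_option linter.dupNamespace false -- `Summit.PneNP.PneNP.…`: summit = sub-problem name (D-0017 single-conjunct layout)

namespace Summit.PneNP.PneNP.Theorems

open Finset

/-- **The shifted quadratic character sum** `Σ_x χ(x(x+a)) = −1` for `a ≠ 0` in a finite field of odd characteristic.
[folklore] -/
theorem sum_quadraticChar_mul_shift {F : Type*} [Field F] [Fintype F] [DecidableEq F] (hF : ringChar F ≠ 2)
    {a : F} (ha : a ≠ 0) : ∑ x : F, quadraticChar F (x * (x + a)) = -1 := by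
  have h2 : ∑ x ∈ univ.erase (0 : F), quadraticChar F (x * (x + a)) = ∑ y ∈ univ.erase (1 : F), quadraticChar F y := by
    refine Finset.sum_nbij' (fun x => 1 + a * x⁻¹) (fun y => a * (y - 1)⁻¹) ?_ ?_ ?_ ?_ ?_
    · intro x hx
      have hx0 : x ≠ 0 := (mem_erase.1 hx).1
      rw [mem_erase]
      refine ⟨fun h => ha ?_, mem_univ _⟩
      have : a * x⁻¹ = 0 := by linear_combination h
      simpa [hx0] using this
    · intro y hy
      have hy1 : y - 1 ≠ 0 := sub_ne_zero.2 (mem_erase.1 hy).1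
      rw [mem_erase]
      exact ⟨mul_ne_zero ha (inv_ne_zero hy1), mem_univ _⟩
    · intro x hx
      have hx0 : x ≠ 0 := (mem_erase.1 hx).1
      have h1 : (1 + a * x⁻¹ - 1) = a * x⁻¹ := by ring
      show a * (1 + a * x⁻¹ - 1)⁻¹ = x
      rw [h1, mul_inv, inv_inv, ← mul_assoc, mul_inv_cancel₀ ha, one_mul]
    · intro y hy
      have hy1 : y - 1 ≠ 0 := sub_ne_zero.2 (mem_erase.1 hy).1
      show 1 + a * (a * (y - 1)⁻¹)⁻¹ = y
      rw [mul_inv, inv_inv, ← mul_assoc, mul_inv_cancel₀ ha, one_mul]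
      ring
    · intro x hx
      have hx0 : x ≠ 0 := (mem_erase.1 hx).1
      have hfac : x * (x + a) = x ^ 2 * (1 + a * x⁻¹) := by
        field_simp
      rw [hfac, map_mul, quadraticChar_sq_one' hx0, one_mul]
  calc ∑ x : F, quadraticChar F (x * (x + a))
      = quadraticChar F (0 * (0 + a)) + ∑ x ∈ univ.erase (0 : F), quadraticChar F (x * (x + a)) :=
        (Finset.add_sum_erase _ _ (mem_univ _)).symm
    _ = ∑ y ∈ univ.erase (1 : F), quadraticChar F y := by rw [zero_mul, quadraticChar_zero, zero_add, h2]
    _ = -1 := by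
        rw [Finset.sum_erase_eq_sub (mem_univ _), quadraticChar_sum_zero hF, map_one]
        ring

/-- **Support item `LegendreFingerprint` of route EcdlpDefinability (stmt-PneNP-2077)**: for `u ≠ u'` in `ZMod p`,
`#{c | IsSquare (u + c) ↔ IsSquare (u' + c)} ≤ p / 2 + 2` (quadratic-character sum `= −1`).
[cite: BlumMicali1984, §3] [folklore] -/
theorem ecdlp_legendreFingerprint_proof : Summit.PneNP.PneNP.Theses.EcdlpDefinability.LegendreFingerprint := by
  unfold Summit.PneNP.PneNP.Theses.EcdlpDefinability.LegendreFingerprint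
  intro p hp u u' huu'
  classical
  rcases hp.out.eq_two_or_odd' with h2 | hodd
  · -- p = 2
    subst h2
    calc (univ.filter fun c : ZMod 2 => (IsSquare (u + c) ↔ IsSquare (u' + c))).card
        ≤ (univ : Finset (ZMod 2)).card := card_filter_le _ _
      _ = 2 := by simp
      _ ≤ 2 / 2 + 2 := by norm_num
  -- odd `p`
  have hchar : ringChar (ZMod p) ≠ 2 := by
    rw [ZMod.ringChar_zmod_n]
    rintro rfl
    exact absurd hodd (by decide)
  set a : ZMod p := u' - u with ha
  have ha0 : a ≠ 0 := sub_ne_zero.2 huu'.symm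
  -- the product of the two character values
  set P : ZMod p → ℤ := fun c => quadraticChar (ZMod p) (u + c) * quadraticChar (ZMod p) (u' + c) with hP
  have hsum : ∑ c, P c = -1 := by
    have h1 : ∑ c, P c = ∑ x : ZMod p, quadraticChar (ZMod p) (x * (x + a)) := by
      rw [← Equiv.sum_comp (Equiv.addLeft u) (fun x => quadraticChar (ZMod p) (x * (x + a)))]
      refine Finset.sum_congr rfl fun c _ => ?_
      simp only [hP, Equiv.coe_addLeft, map_mul]
      congr 2
      rw [ha]
      ring
    rw [h1]
    exact sum_quadraticChar_mul_shift hchar ha0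
  -- trichotomy of the values
  have hvals : ∀ c, P c = 1 ∨ P c = -1 ∨ P c = 0 := by
    intro c
    simp only [hP]
    by_cases h1 : u + c = 0
    · right; right; rw [h1, quadraticChar_zero, zero_mul]
    by_cases h2 : u' + c = 0
    · right; right; rw [h2, quadraticChar_zero, mul_zero]
    rcases quadraticChar_dichotomy h1 with e1 | e1 <;> rcases quadraticChar_dichotomy h2 with e2 | e2 <;>
      simp [e1, e2]
  -- the zero set is `{-u, -u'}`
  have hzero : ∀ c, P c = 0 ↔ c = -u ∨ c = -u' := by
    intro c
    simp only [hP, mul_eq_zero, quadraticChar_eq_zero_iff]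
    constructor
    · rintro (h | h)
      · left; linear_combination h
      · right; linear_combination h
    · rintro (rfl | rfl)
      · left; ring
      · right; ring
  -- counting
  set T₁ := univ.filter fun c => P c = 1 with hT₁
  set Tm := univ.filter fun c => P c = -1 with hTm
  set T₀ := univ.filter fun c => P c = 0 with hT₀
  have hsplit : ∑ c, P c = (T₁.card : ℤ) - Tm.card := by
    have hpt : ∀ c, P c = (if P c = 1 then 1 else 0) + (if P c = -1 then -1 else 0) := by
      intro c; rcases hvals c with h | h | h <;> simp [h]
    rw [Finset.sum_congr rfl fun c _ => hpt c, sum_add_distrib]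
    rw [← Finset.sum_filter, ← Finset.sum_filter]
    simp [hT₁, hTm, sum_const, sub_eq_add_neg]
  have htot : (T₁.card : ℤ) + Tm.card + T₀.card = p := by
    have hpt : ∀ c, (if P c = 1 then (1 : ℤ) else 0) + (if P c = -1 then 1 else 0) + (if P c = 0 then 1 else 0) = 1 := by
      intro c; rcases hvals c with h | h | h <;> simp [h]
    have hs := Finset.sum_congr rfl fun (c : ZMod p) (_ : c ∈ univ) => hpt c
    rw [sum_add_distrib, sum_add_distrib] at hs
    simp only [sum_boole, sum_const, card_univ, ZMod.card, nsmul_eq_mul, mul_one] at hs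
    simpa [hT₁, hTm, hT₀] using hs
  have hT0 : T₀.card = 2 := by
    have : T₀ = {-u, -u'} := by
      ext c
      simp only [hT₀, mem_filter, mem_univ, true_and, mem_insert, mem_singleton, hzero]
    rw [this, card_pair]
    intro h
    exact huu' (neg_injective h)
  -- agreements avoid `Tm`
  have hdisj : Disjoint (univ.filter fun c : ZMod p => (IsSquare (u + c) ↔ IsSquare (u' + c))) Tm := by
    rw [Finset.disjoint_left]
    intro c hc hcm
    rw [mem_filter] at hc hcm
    have hiff := hc.2
    have hm : P c = -1 := hcm.2
    simp only [hP] at hm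
    have h1 : u + c ≠ 0 := fun h => by rw [h, quadraticChar_zero, zero_mul] at hm; exact absurd hm (by norm_num)
    have h2 : u' + c ≠ 0 := fun h => by rw [h, quadraticChar_zero, mul_zero] at hm; exact absurd hm (by norm_num)
    rw [← not_iff_not, ← quadraticChar_neg_one_iff_not_isSquare, ← quadraticChar_neg_one_iff_not_isSquare] at hiff
    rcases quadraticChar_dichotomy h1 with e1 | e1 <;> rcases quadraticChar_dichotomy h2 with e2 | e2
    · rw [e1, e2] at hm; norm_num at hm
    · exact absurd (hiff.2 e2) (by rw [e1]; norm_num)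
    · exact absurd (hiff.1 e1) (by rw [e2]; norm_num)
    · rw [e1, e2] at hm; norm_num at hm
  have hcardle : (univ.filter fun c : ZMod p => (IsSquare (u + c) ↔ IsSquare (u' + c))).card + Tm.card ≤ p := by
    rw [← card_union_of_disjoint hdisj]
    exact (card_le_univ _).trans_eq (ZMod.card p)
  have hsumZ : (T₁.card : ℤ) - Tm.card = -1 := by rw [← hsplit, hsum]
  have hT0Z : (T₀.card : ℤ) = 2 := by exact_mod_cast hT0
  omega

end Summit.PneNP.PneNP.Theorems
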